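import Literature.MathematicalPhysics.QuantumLattice.FermionConditionalFreeEnergyCertificate
import Literature.LinearAlgebra.Matrix.HermitianCfcDiagonalForm
import HarnessLib

/-!
# The conditional free-energy certificate from RATIONAL ENCLOSURES of the exponentials

Topic `MathematicalPhysics/QuantumLattice`; companion of `FermionConditionalFreeEnergyCertificate.lean`
(`fermion_condFreeEnergy_le_of_certificate`: `S(σ) − S(σ_{Λ∖a}) − Re tr(σ H) ≤ c` whenever
`e^c·e^{L_B} − tr_{Λ→Λ∖a} e^{−H + Γ L_B} ⪰ 0`). The thermal-SDP producers' «cent-lb» rows use the window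
witnesses `H = G − Γ G_W`, `L_B = −G_W` with EXACTLY DIAGONALISED rational Hermitian matrices
`G = V diag(g) V*`, `G_W = V_W diag(u) V_W*` (Cayley-rational unitaries, dyadic spectra), for which the
certificate reads `e^c e^{−G_W} − tr_a e^{−G} ⪰ 0`. The exponentials are irrational; the producer certifies
instead, in exact arithmetic, (i) an upper enclosure `Z⁺ ⪰ tr_a (V diag(e⁺) V*)` with `e⁺_k ≥ e^{−g_k}`, and
(ii) `c_l · V_W diag(e_l) V_W* − Z⁺ ⪰ 0` with `e_l,k ≤ e^{−u_k}`, `0 ≤ e_l`, `c_l ≤ e^c`. This file PROVES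
that (i)+(ii) imply the certificate hypothesis, verbatim in the shape consumed by
`fermion_condFreeEnergy_le_of_certificate` (and hence by `TorusSectorGibbsCondEntropyRow.lean`):

* `fermion_condFreeEnergy_certificate_of_enclosures`;
* for the unconditional «ent» rows (constant `log Tr e^{−G}`): `partitionFn_eq_sum_exp_of_conj_diagonal`
  (`Tr e^{−βG} = Σ_k e^{−β g_k}` for an exactly diagonalised `G`) and
  `log_re_partitionFn_one_nonpos_of_enclosures` (`Σ_k e⁺_k ≤ 1`, `e⁺_k ≥ e^{−g_k}` ⇒ `log Re Tr e^{−G} ≤ 0` —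
  the producers' «lemma_sum_upper»).

Tools: `cfc f (V diag μ V*) = V diag(f∘μ) V*` for ANY unitary diagonalisation
(`Literature.LinearAlgebra.Matrix.cfc_eq_conj_diagonal`), positivity and linearity of the fermionic
partial trace. Everything is PROVED; no definition, no named fact.

References: Poulin–Hastings 2011 eqs. (4)–(8) [PoulinHastings2011]; Kull et al. 2024 §5.3 (rounded, exactly
checked certificates) [KullEtAl2024].
-/

noncomputable section

namespace Literature.MathematicalPhysics.QuantumLattice

open Matrix Finset HubbardWave0 Literature.Probability.LatticeModels
open Literature.LinearAlgebra.Matrix (cfc_eq_conj_diagonal trace_cfc_eq_sum isHermitian_conj_diagonal)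
open scoped ComplexOrder Matrix.Norms.L2Operator

variable {d : ℕ}

/-- `V diag(δ) V*` is positive semidefinite for `δ ≥ 0`. [folklore] -/
private theorem posSemidef_conj_diagonal {ι : Type*} [Fintype ι] [DecidableEq ι] (V : Matrix ι ι ℂ)
    {δ : ι → ℝ} (hδ : ∀ k, 0 ≤ δ k) :
    (V * diagonal (fun k => ((δ k : ℝ) : ℂ)) * star V).PosSemidef := by
  rw [Matrix.star_eq_conjTranspose]
  exact (Matrix.PosSemidef.diagonal (fun k => Complex.zero_le_real.2 (hδ k))).mul_mul_conjTranspose_same V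

/-- `r·(V diag p V*) − s·(V diag q V*) = V diag(r p − s q) V*`. [folklore] -/
private theorem smul_conj_diagonal_sub {ι : Type*} [Fintype ι] [DecidableEq ι] (V : Matrix ι ι ℂ)
    (p q : ι → ℝ) (r s : ℝ) :
    ((r : ℝ) : ℂ) • (V * diagonal (fun k => ((p k : ℝ) : ℂ)) * star V) -
        ((s : ℝ) : ℂ) • (V * diagonal (fun k => ((q k : ℝ) : ℂ)) * star V) =
      V * diagonal (fun k => (((r * p k - s * q k : ℝ)) : ℂ)) * star V := by
  rw [show ((r : ℝ) : ℂ) • (V * diagonal (fun k => ((p k : ℝ) : ℂ)) * star V) =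
      V * (((r : ℝ) : ℂ) • diagonal (fun k => ((p k : ℝ) : ℂ))) * star V by rw [Matrix.mul_smul, Matrix.smul_mul],
    show ((s : ℝ) : ℂ) • (V * diagonal (fun k => ((q k : ℝ) : ℂ)) * star V) =
      V * (((s : ℝ) : ℂ) • diagonal (fun k => ((q k : ℝ) : ℂ))) * star V by rw [Matrix.mul_smul, Matrix.smul_mul],
    ← Matrix.sub_mul, ← Matrix.mul_sub, ← diagonal_smul, ← diagonal_smul, diagonal_sub]
  congr 2
  funext k
  simp only [Pi.smul_apply, smul_eq_mul]
  push_cast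
  ring

/-- `V diag p V* − V diag q V* = V diag(p − q) V*`. [folklore] -/
private theorem conj_diagonal_sub {ι : Type*} [Fintype ι] [DecidableEq ι] (V : Matrix ι ι ℂ) (p q : ι → ℝ) :
    V * diagonal (fun k => ((p k : ℝ) : ℂ)) * star V - V * diagonal (fun k => ((q k : ℝ) : ℂ)) * star V =
      V * diagonal (fun k => (((p k - q k : ℝ)) : ℂ)) * star V := by
  have h := smul_conj_diagonal_sub V p q 1 1
  simpa only [Complex.ofReal_one, one_smul, one_mul] using h

/-- **The certificate from rational enclosures.** Let `G = V diag(g) V* ∈ 𝔄_Λ` and `G_W = V_W diag(u) V_W* ∈ 𝔄_{Λ∖a}`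
be exactly diagonalised (`V, V_W` unitary, real spectra), `e⁺ ≥ e^{−g}` and `0 ≤ e_l ≤ e^{−u}` termwise,
`c_l ≤ e^c`, and suppose `Z⁺ − tr_{Λ→Λ∖a}(V diag(e⁺) V*) ⪰ 0` and `c_l·V_W diag(e_l) V_W* − Z⁺ ⪰ 0` (two exact
semidefinite tests). Then the dual certificate of `fermion_condFreeEnergy_le_of_certificate` holds for
`H = G − Γ G_W`, `L_B = −G_W`: `e^c·exp(−G_W) − tr_{Λ→Λ∖a} exp(−(G − Γ G_W) + Γ(−G_W)) ⪰ 0`.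
[cite: PoulinHastings2011, eqs. (4)–(8)] [cite: KullEtAl2024, §5.3] -/
theorem fermion_condFreeEnergy_certificate_of_enclosures {Λ : Finset (Site d)} {a : Site d}
    {G V : FermionOp Λ} (hV : V ∈ Matrix.unitaryGroup (Finset (Orb (PolySite Λ))) ℂ)
    {g : Finset (Orb (PolySite Λ)) → ℝ} (hG : G = V * diagonal (fun k => ((g k : ℝ) : ℂ)) * star V)
    {GW VW : FermionOp (Λ.erase a)} (hVW : VW ∈ Matrix.unitaryGroup (Finset (Orb (PolySite (Λ.erase a)))) ℂ)
    {u : Finset (Orb (PolySite (Λ.erase a))) → ℝ} (hGW : GW = VW * diagonal (fun k => ((u k : ℝ) : ℂ)) * star VW)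
    {ep : Finset (Orb (PolySite Λ)) → ℝ} (hep : ∀ k, Real.exp (-g k) ≤ ep k)
    {el : Finset (Orb (PolySite (Λ.erase a))) → ℝ} (hel : ∀ k, el k ≤ Real.exp (-u k)) (hel0 : ∀ k, 0 ≤ el k)
    {c cl : ℝ} (hcl : cl ≤ Real.exp c)
    {Zp : FermionOp (Λ.erase a)}
    (hZ : (Zp - fermionPartialTrace (PolySite.incl (Λ.erase_subset a))
      (V * diagonal (fun k => ((ep k : ℝ) : ℂ)) * star V)).PosSemidef)
    (hcert : (((cl : ℝ) : ℂ) • (VW * diagonal (fun k => ((el k : ℝ) : ℂ)) * star VW) - Zp).PosSemidef) :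
    ((Real.exp c : ℂ) • cfc Real.exp (-GW) -
      fermionPartialTrace (PolySite.incl (Λ.erase_subset a))
        (cfc Real.exp (-(G - fermionEmbed (PolySite.incl (Λ.erase_subset a)) GW) +
          fermionEmbed (PolySite.incl (Λ.erase_subset a)) (-GW)))).PosSemidef := by
  -- the exponent is `−G`
  have hexp : -(G - fermionEmbed (PolySite.incl (Λ.erase_subset a)) GW) +
      fermionEmbed (PolySite.incl (Λ.erase_subset a)) (-GW) = -G := by
    rw [map_neg]
    abel
  -- exact diagonalisations of `−G`, `−G_W`
  have hnegG : -G = V * diagonal (fun k => (((-g k : ℝ)) : ℂ)) * star V := by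
    rw [hG, ← Matrix.neg_mul, ← Matrix.mul_neg, diagonal_neg]
    congr 2
    funext k
    push_cast
    ring
  have hnegGW : -GW = VW * diagonal (fun k => (((-u k : ℝ)) : ℂ)) * star VW := by
    rw [hGW, ← Matrix.neg_mul, ← Matrix.mul_neg, diagonal_neg]
    congr 2
    funext k
    push_cast
    ring
  have hcfcG : cfc Real.exp (-G) = V * diagonal (fun k => ((Real.exp (-g k) : ℝ) : ℂ)) * star V :=
    cfc_eq_conj_diagonal hV hnegG Real.exp
  have hcfcGW : cfc Real.exp (-GW) = VW * diagonal (fun k => ((Real.exp (-u k) : ℝ) : ℂ)) * star VW :=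
    cfc_eq_conj_diagonal hVW hnegGW Real.exp
  rw [hexp, hcfcG, hcfcGW]
  -- the four positive pieces
  have t1 : (((Real.exp c : ℝ) : ℂ) • (VW * diagonal (fun k => ((Real.exp (-u k) : ℝ) : ℂ)) * star VW) -
      ((cl : ℝ) : ℂ) • (VW * diagonal (fun k => ((el k : ℝ) : ℂ)) * star VW)).PosSemidef := by
    rw [smul_conj_diagonal_sub]
    refine posSemidef_conj_diagonal VW fun k => ?_
    have h1 : cl * el k ≤ Real.exp c * el k := mul_le_mul_of_nonneg_right hcl (hel0 k)
    have h2 : Real.exp c * el k ≤ Real.exp c * Real.exp (-u k) :=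
      mul_le_mul_of_nonneg_left (hel k) (Real.exp_pos c).le
    linarith
  have t4 : (fermionPartialTrace (PolySite.incl (Λ.erase_subset a)) (V * diagonal (fun k => ((ep k : ℝ) : ℂ)) * star V) -
      fermionPartialTrace (PolySite.incl (Λ.erase_subset a))
        (V * diagonal (fun k => ((Real.exp (-g k) : ℝ) : ℂ)) * star V)).PosSemidef := by
    rw [← map_sub, conj_diagonal_sub]
    exact posSemidef_fermionPartialTrace _ (posSemidef_conj_diagonal V fun k => by linarith [hep k])
  have key := ((t1.add hcert).add hZ).add t4
  have heq : ((Real.exp c : ℂ)) • (VW * diagonal (fun k => ((Real.exp (-u k) : ℝ) : ℂ)) * star VW) -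
      fermionPartialTrace (PolySite.incl (Λ.erase_subset a))
        (V * diagonal (fun k => ((Real.exp (-g k) : ℝ) : ℂ)) * star V) =
      (((Real.exp c : ℝ) : ℂ) • (VW * diagonal (fun k => ((Real.exp (-u k) : ℝ) : ℂ)) * star VW) -
          ((cl : ℝ) : ℂ) • (VW * diagonal (fun k => ((el k : ℝ) : ℂ)) * star VW)) +
        (((cl : ℝ) : ℂ) • (VW * diagonal (fun k => ((el k : ℝ) : ℂ)) * star VW) - Zp) +
        (Zp - fermionPartialTrace (PolySite.incl (Λ.erase_subset a)) (V * diagonal (fun k => ((ep k : ℝ) : ℂ)) * star V)) +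
        (fermionPartialTrace (PolySite.incl (Λ.erase_subset a)) (V * diagonal (fun k => ((ep k : ℝ) : ℂ)) * star V) -
          fermionPartialTrace (PolySite.incl (Λ.erase_subset a))
            (V * diagonal (fun k => ((Real.exp (-g k) : ℝ) : ℂ)) * star V)) := by
    abel
  rw [heq]
  exact key


/-! ### The constant of an «ent» row from an exact diagonalisation -/

section EntConstant

variable {ι : Type*} [Fintype ι] [DecidableEq ι]

/-- **`Tr e^{−βG} = Σ_k e^{−β g_k}`** for an exactly diagonalised `G = V diag(g) V*` (`V` unitary, any — not
necessarily Mathlib's — eigenbasis). [cite: KullEtAl2024, §5.3] -/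
theorem partitionFn_eq_sum_exp_of_conj_diagonal {G V : Matrix ι ι ℂ} (hV : V ∈ Matrix.unitaryGroup ι ℂ)
    {g : ι → ℝ} (hG : G = V * diagonal (fun k => ((g k : ℝ) : ℂ)) * star V) (β : ℝ) :
    partitionFn β G = ((∑ k, Real.exp (-(β * g k)) : ℝ) : ℂ) := by
  have hGh : G.IsHermitian := by rw [hG]; exact isHermitian_conj_diagonal V g
  have hsa : IsSelfAdjoint ((-β) • G) := IsSelfAdjoint.smul (IsSelfAdjoint.all (-β)) hGh.isSelfAdjoint
  have hsmul : (-(β : ℂ) • G : Matrix ι ι ℂ) = (-β : ℝ) • G := by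
    ext i j
    simp [Matrix.smul_apply, Complex.real_smul]
  have h1 : gibbsWeight β G = cfc (fun x : ℝ => Real.exp (-(β * x))) G := by
    have hfun : (fun x : ℝ => Real.exp (-(β * x))) = fun x => Real.exp ((-β) • x) := by
      funext x
      simp only [smul_eq_mul, neg_mul]
    rw [hfun, gibbsWeight, hsmul, cfc_comp_smul (-β) Real.exp G, CFC.real_exp_eq_normedSpace_exp hsa]
  rw [partitionFn, h1, trace_cfc_eq_sum hV hG]
  norm_cast

/-- **The «lemma_sum_upper» of the ent rows**: if `e⁺_k ≥ e^{−g_k}` termwise and `Σ_k e⁺_k ≤ 1` (exact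
rationals), then `log Re Tr e^{−G} ≤ 0` for `G = V diag(g) V*` — so the constant of the entropy row can be
taken `0`. [cite: KullEtAl2024, §5.3] -/
theorem log_re_partitionFn_one_nonpos_of_enclosures {G V : Matrix ι ι ℂ} (hV : V ∈ Matrix.unitaryGroup ι ℂ)
    {g : ι → ℝ} (hG : G = V * diagonal (fun k => ((g k : ℝ) : ℂ)) * star V)
    {ep : ι → ℝ} (hep : ∀ k, Real.exp (-g k) ≤ ep k) (hsum : ∑ k, ep k ≤ 1) :
    Real.log (partitionFn 1 G).re ≤ 0 := by
  rw [partitionFn_eq_sum_exp_of_conj_diagonal hV hG 1, Complex.ofReal_re]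
  simp only [one_mul]
  rcases isEmpty_or_nonempty ι with hι | hι
  · simp
  have hpos : 0 < ∑ k, Real.exp (-g k) := Finset.sum_pos (fun k _ => Real.exp_pos _) Finset.univ_nonempty
  have hle : ∑ k, Real.exp (-g k) ≤ 1 := (Finset.sum_le_sum fun k _ => hep k).trans hsum
  exact Real.log_nonpos hpos.le hle

end EntConstant

end Literature.MathematicalPhysics.QuantumLattice

end
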